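import Summits.Parity.GeneralizedHardyLittlewood.Theorems.PrimeLevelFamEdgeMomentsBeyondDiagonalDiagDecorPrimePow
import HarnessLib

/-!
# Route `PrimeLevelFamEdge`, crux K_A `MomentsBeyondDiagonal` (stmt-Parity-20007), line «petersson_layers» v4, stub `stub_diag`:
# **the `P_{i+1}`-decorated coprime Selberg sum at the bottom order `c = 2`, and the uniform statement for all `c ≥ 2`**

Fourth brick of the `M₄`-engine asked for by rung 2 of `stub_diag` (`…DiagRungTwoOfM4`): the order `c = 2` of
`…DiagDecorPrimePow.abs_coprimeSumPow_primePow_add_le` (there `c ≥ 3`), word for word the proof of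
`…DiagDecorPrimeSq.abs_coprimeSum_primeSq_add_le` with `log²p ↦ log^{i+1}p` (termwise `…DiagDecorPrimePowTerm.abs_primePow_term_two_sub_le`,
Mertens moment `…DiagPrimeSumLogPow.abs_sum_primeWeight_coprime_logPow_mul_log_pow_sub_le` at `a = 0`, dyadic prime sum
`…DiagPrimeCoupling.sum_prime_log_div_dyadic_le`), stated in the SAME shape as the `c ≥ 3` theorem so that the two glue:

* `abs_coprimeSumTwo_primePow_add_le` — `c = 2`;
* `abs_coprimeSumPow_primePow_add_le_of_two_le` — **all `c ≥ 2`: `|Σ_{k≤y} a_n(k)logᶜ(y/k)P_{i+1}(k)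
  + 2c(c−1)(i!(c−2)!/(c−2+i+1)!)E_n log^{c−2+i+1}y| ≤ C·D(n)(1+κ(n))(1+log y)^{c−2+i}`** — the master-input precursor for the
  decorations `P_{i+1}` (profile form: next brick), in particular the `P₄`-engine (`i = 3`).

Def-free; theorems only. Helper `--supports stmt-Parity-20007`; closes nothing; K_A, K_B and the Parity summit are NOT proved;
nothing about Landau–Siegel zeros.

## References
* E. Kowalski, P. Michel, J. VanderKam, J. reine angew. Math. 526 (2000), (23)–(28) pp. 13–15 and Prop. 5.1 p. 18.
  [cite: KowalskiMichelVanderKam2000, (23)–(28) — derivation (prime-power-log decorations of the Selberg coordinates)]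
* T. M. Apostol, *Introduction to Analytic Number Theory*, Springer 1976, Thm 4.9 (Mertens). [cite: Apostol1976, Thm 4.9 — derivation]
-/

noncomputable section

open scoped Real
open Finset ArithmeticFunction

namespace Summit.Parity.GeneralizedHardyLittlewood.Theorems.MomentsBeyondDiagonal.DiagKernel

open Literature.NumberTheory.LFunctions Literature.NumberTheory.LFunctions.KMV2000
open SelbergCoord (kappa)
open Summit.Parity.GeneralizedHardyLittlewood.Theorems.BeyondDiagonalBeatsQuarter.KernelFormXSq
  (copTauW mainConst divWeight divWeight_nonneg mainConst_nonneg mainConst_le_divWeight abs_coprimeSum_sub_le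
    sum_prime_log_div_succ_le)
open Summit.Parity.GeneralizedHardyLittlewood.Theorems.MomentsBeyondDiagonal.DiagLines
  (sum_copTauW_mul_mul_sum_primeFactors_eq)

/-- **The `P_{i+1}`-decorated coprime Selberg sum, order `c = 2`** (stated in the shape of the `c ≥ 3` theorem at `c = 2`):
there is `C` such that for all `n ≥ 1`, `y ≥ 1`:
`|Σ_{k≤y} a_n(k)·log²(y/k)·Σ_{p∣k}log^{i+1}p + 2·(2·1)·(i!·0!/(0+i+1)!)·E_n·log^{i+1}y| ≤ C·D(n)·(1+κ(n))·(1+log y)^i`.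
[cite: KowalskiMichelVanderKam2000, (23)–(28) and Prop. 5.1 — derivation (prime-power-log decoration, real variables)] -/
theorem abs_coprimeSumTwo_primePow_add_le (i : ℕ) :
    ∃ C : ℝ, 0 < C ∧ ∀ n : ℕ, n ≠ 0 → ∀ y : ℝ, 1 ≤ y →
      |∑ k ∈ Icc 1 ⌊y⌋₊, copTauW n k * Real.log (y / k) ^ 2 * ∑ p ∈ k.primeFactors, Real.log p ^ (i + 1) +
          2 * (((2 : ℕ) : ℝ) * (((2 : ℕ) : ℝ) - 1)) * ((i.factorial : ℝ) * (2 - 2).factorial / (2 - 2 + i + 1).factorial) *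
            mainConst n * Real.log y ^ (2 - 2 + i + 1)| ≤
        C * divWeight n * (1 + kappa n) * (1 + Real.log y) ^ (2 - 2 + i) := by
  obtain ⟨C, hC0, hC⟩ := abs_coprimeSum_sub_le
  obtain ⟨C_E, hC_E, hE⟩ := mainConst_le_divWeight
  refine ⟨64 * C + 76 * 2 ^ i * C_E, by positivity, fun n hn y hy ↦ ?_⟩
  have hy0 : 0 < y := by linarith
  have hly : 0 ≤ Real.log y := Real.log_nonneg hy
  have hκ : 0 ≤ kappa n := by
    unfold kappa
    exact Finset.sum_nonneg fun p hp ↦ by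
      have hp2 : (2 : ℝ) ≤ p := by exact_mod_cast (Nat.prime_of_mem_primeFactors hp).two_le
      exact div_nonneg (Real.log_nonneg (by linarith)) (by linarith)
  have hD := divWeight_nonneg n
  have hE0 := mainConst_nonneg n
  have hEn := hE n hn
  have hl4 : Real.log 4 ≤ 2 := by
    have := Real.log_two_lt_d9
    have h4 : Real.log 4 = 2 * Real.log 2 := by
      rw [show (4 : ℝ) = 2 ^ 2 by norm_num, Real.log_pow]; ring
    rw [h4]; linarith
  have hl40 : 0 ≤ Real.log 4 := Real.log_nonneg (by norm_num)
  simp only [show (2 : ℕ) - 2 = 0 from rfl, Nat.zero_add]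
  set N := ⌊y⌋₊ with hN
  -- Step 1: the decorated sum as a prime sum of inner coprime sums
  have h := sum_copTauW_mul_mul_sum_primeFactors_eq n N (fun k : ℕ ↦ Real.log (y / k) ^ 2)
    (fun p : ℕ ↦ Real.log p ^ (i + 1))
  beta_reduce at h
  rw [h, Finset.sum_filter]
  obtain ⟨T, hT⟩ : ∃ T : ℕ → ℝ, ∀ p, T p = if p.Prime then Real.log p ^ (i + 1) * copTauW n p *
      ∑ k ∈ Icc 1 (N / p), copTauW (n * p) k * Real.log (y / ((p * k : ℕ) : ℝ)) ^ 2 else 0 :=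
    ⟨_, fun _ ↦ rfl⟩
  obtain ⟨v, hv⟩ : ∃ v : ℕ → ℝ, ∀ p, v p = if p.Prime ∧ ¬ p ∣ n then Real.log p / ((p : ℝ) - 1) else 0 :=
    ⟨_, fun _ ↦ rfl⟩
  simp only [← hT]
  set K : ℝ := 4 * C * divWeight n * Real.log y ^ i with hK
  have hK0 : 0 ≤ K := by positivity
  set k : ℝ := -4 * mainConst n with hk
  set q : ℝ := (i.factorial : ℝ) * (Nat.factorial 0) / (i + 1).factorial with hq
  have hq0 : 0 ≤ q := by positivity
  have hmain' : |∑ p ∈ Icc 1 N, v p * Real.log p ^ i - q * Real.log y ^ (i + 1)| ≤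
      2 ^ i * (19 + kappa n) * (1 + Real.log y) ^ i := by
    have hm := abs_sum_primeWeight_coprime_logPow_mul_log_pow_sub_le hn hy i 0
    simp only [← hv, pow_zero, mul_one, Nat.zero_add] at hm
    rw [← hq] at hm
    exact hm
  have hterm : ∀ p ∈ Icc 1 N, |T p - k * (v p * Real.log p ^ i)| ≤
      (if p.Prime then Real.log p else 0) / ((p : ℝ) * (1 + Real.log (y / p)) ^ 2) * K := by
    intro p hp
    rw [hT p, hv p]
    exact abs_primePow_term_two_sub_le i hC0.le hC hn hy hp
  -- Step 2: split off the main part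
  have hsplit : ∑ p ∈ Icc 1 N, T p + 2 * (((2 : ℕ) : ℝ) * (((2 : ℕ) : ℝ) - 1)) * q * mainConst n * Real.log y ^ (i + 1) =
      ∑ p ∈ Icc 1 N, (T p - k * (v p * Real.log p ^ i)) +
        k * (∑ p ∈ Icc 1 N, v p * Real.log p ^ i - q * Real.log y ^ (i + 1)) := by
    rw [Finset.sum_sub_distrib, ← Finset.mul_sum, hk]
    push_cast
    ring
  rw [hsplit]
  have hA : |∑ p ∈ Icc 1 N, (T p - k * (v p * Real.log p ^ i))| ≤ 8 * Real.log 4 * K := by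
    calc _ ≤ ∑ p ∈ Icc 1 N, |T p - k * (v p * Real.log p ^ i)| := Finset.abs_sum_le_sum_abs _ _
      _ ≤ ∑ p ∈ Icc 1 N, (if p.Prime then Real.log p else 0) / ((p : ℝ) * (1 + Real.log (y / p)) ^ 2) * K :=
          Finset.sum_le_sum hterm
      _ = (∑ p ∈ Icc 1 N, (if p.Prime then Real.log p else 0) / ((p : ℝ) * (1 + Real.log (y / p)) ^ 2)) * K := by
          rw [Finset.sum_mul]
      _ ≤ 8 * Real.log 4 * K := mul_le_mul_of_nonneg_right (sum_prime_log_div_dyadic_le hy) hK0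
  have hB : |k * (∑ p ∈ Icc 1 N, v p * Real.log p ^ i - q * Real.log y ^ (i + 1))| ≤
      4 * mainConst n * (2 ^ i * (19 + kappa n) * (1 + Real.log y) ^ i) := by
    rw [abs_mul]
    have hkabs : |k| = 4 * mainConst n := by
      rw [hk, abs_mul, abs_of_nonneg hE0]; norm_num
    rw [hkabs]
    exact mul_le_mul_of_nonneg_left hmain' (by positivity)
  have hX0 : 0 ≤ (1 + Real.log y) ^ i := by positivity
  have hLi : Real.log y ^ i ≤ (1 + Real.log y) ^ i := pow_le_pow_left₀ hly (by linarith) i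
  calc _ ≤ |∑ p ∈ Icc 1 N, (T p - k * (v p * Real.log p ^ i))| +
        |k * (∑ p ∈ Icc 1 N, v p * Real.log p ^ i - q * Real.log y ^ (i + 1))| := abs_add_le _ _
    _ ≤ 8 * Real.log 4 * K + 4 * mainConst n * (2 ^ i * (19 + kappa n) * (1 + Real.log y) ^ i) := add_le_add hA hB
    _ = 32 * Real.log 4 * C * divWeight n * Real.log y ^ i +
        4 * 2 ^ i * mainConst n * (19 + kappa n) * (1 + Real.log y) ^ i := by
        rw [hK]; ring
    _ ≤ 64 * C * divWeight n * (1 + kappa n) * (1 + Real.log y) ^ i +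
        76 * 2 ^ i * C_E * divWeight n * (1 + kappa n) * (1 + Real.log y) ^ i := by
        have i1 : 32 * Real.log 4 * C * divWeight n * Real.log y ^ i ≤
            64 * C * divWeight n * (1 + kappa n) * (1 + Real.log y) ^ i := by
          have j1 : 32 * Real.log 4 * C * divWeight n ≤ 64 * C * divWeight n * (1 + kappa n) := by
            calc 32 * Real.log 4 * C * divWeight n ≤ 32 * 2 * C * divWeight n := by
                  have : 0 ≤ C * divWeight n := by positivity
                  nlinarith
              _ = 64 * C * divWeight n * 1 := by ring
              _ ≤ 64 * C * divWeight n * (1 + kappa n) :=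
                  mul_le_mul_of_nonneg_left (by linarith) (by positivity)
          exact mul_le_mul j1 hLi (by positivity) (by positivity)
        have i2 : 4 * 2 ^ i * mainConst n * (19 + kappa n) * (1 + Real.log y) ^ i ≤
            76 * 2 ^ i * C_E * divWeight n * (1 + kappa n) * (1 + Real.log y) ^ i := by
          apply mul_le_mul_of_nonneg_right _ hX0
          have j2 : mainConst n * (19 + kappa n) ≤ (C_E * divWeight n) * (19 * (1 + kappa n)) :=
            mul_le_mul hEn (by linarith) (by positivity) (by positivity)
          have h2i : (0 : ℝ) ≤ 2 ^ i := by positivity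
          linarith [mul_le_mul_of_nonneg_left j2 h2i]
        exact add_le_add i1 i2
    _ = (64 * C + 76 * 2 ^ i * C_E) * divWeight n * (1 + kappa n) * (1 + Real.log y) ^ i := by ring

/-- **The `P_{i+1}`-decorated coprime Selberg sum, ALL orders `c ≥ 2`** (uniform statement; `c = 2`:
`abs_coprimeSumTwo_primePow_add_le`, `c ≥ 3`: `…DiagDecorPrimePow.abs_coprimeSumPow_primePow_add_le`).
[cite: KowalskiMichelVanderKam2000, (23)–(28) and Prop. 5.1 — derivation (prime-power-log decoration, real variables)] -/
theorem abs_coprimeSumPow_primePow_add_le_of_two_le (i : ℕ) {c : ℕ} (hc : 2 ≤ c) :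
    ∃ C : ℝ, 0 < C ∧ ∀ n : ℕ, n ≠ 0 → ∀ y : ℝ, 1 ≤ y →
      |∑ k ∈ Icc 1 ⌊y⌋₊, copTauW n k * Real.log (y / k) ^ c * ∑ p ∈ k.primeFactors, Real.log p ^ (i + 1) +
          2 * ((c : ℝ) * ((c : ℝ) - 1)) * ((i.factorial : ℝ) * (c - 2).factorial / (c - 2 + i + 1).factorial) *
            mainConst n * Real.log y ^ (c - 2 + i + 1)| ≤
        C * divWeight n * (1 + kappa n) * (1 + Real.log y) ^ (c - 2 + i) := by
  rcases Nat.eq_or_lt_of_le hc with h | h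
  · subst h
    exact abs_coprimeSumTwo_primePow_add_le i
  · exact abs_coprimeSumPow_primePow_add_le i h

end Summit.Parity.GeneralizedHardyLittlewood.Theorems.MomentsBeyondDiagonal.DiagKernel

end
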